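import Summits.ResolutionOfSingularities.ResolutionOfSingularities.Theorems.HilbertSamuelEliminationCampaignW42VertexGame
import Summits.ResolutionOfSingularities.ResolutionOfSingularities.Theorems.HilbertSamuelEliminationCampaignW42VertexGameRank
import Summits.ResolutionOfSingularities.ResolutionOfSingularities.Theorems.HilbertSamuelEliminationCampaignW42VertexGame2
import Literature.Combinatorics.HironakaPolyhedraGame.Spivakovsky1983
import Mathlib.Data.Fin.VecNotation
import Mathlib.Tactic.IntervalCases
import Mathlib.Tactic.FieldSimp

/-!
# [OURS · L1 W4.2] The vertex games ARE plays of Hironaka's polyhedra game (Literature, [Spivakovsky1983]) — the dictionary,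
# and the witness play as an infinite legal play that is never won (pure proofs; `--supports stmt-ResolutionOfSingularities-19964`)

HONEST FRAMING. OURS (seat res-L1-s42-pv-2, slot W4.2 / obstruction O2); nothing here is a statement of H. Hironaka's manuscript
[Hironaka2017]; AI-made, AI review is weaker than expert review. Combinatorics only: the positions of the one- and two-vertex games
(`…VertexGame.lean` p510005, `…VertexGame2.lean` p516000) are sent to generator sets of Hironaka's polyhedra game as typed in
`Literature/Combinatorics/HironakaPolyhedraGame/Spivakovsky1983.lean` (`gen m a = a/m`), and every move of the CJS label rule followed
into chart `c` is shown to be the printed move `σ_{U,c}` (`gameMove U c`) with `U` permissible (`IsPermissible`). Consequences: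
(1) on torus-fixed W-top positions the CJS label rule is a LEGAL (history-dependent) strategy of player A, the chart is player B's
answer; (2) «not yet won» (`¬ Won`) is exactly «every vertex has `|v| > m`», i.e. the initial form is still `y^m` (the W-top grade);
(3) the witness play of p516000 is an infinite sequence of legal moves of Hironaka's game in dimension `3` NONE of whose positions is
won (`witness_never_won`) — the CJS label rule LOSES against player B's chart answers, whereas Spivakovsky's positional strategy wins
from every position (`Literature…Spivakovsky1983_winningStrategy`, discharged in the tree). This is the dictionary the chain's v8
re-scope (RULINGS v3.12-5 (AB), V8-c) asks for, at torus-fixed states; it says nothing about schemes.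

CORRECTION to the module docstring of `…VertexGame2.lean` (p516000), which says of isolated origins «where the model cannot loop»:
what is established is only EMPIRICAL — no POINTED start (the point `{0,1,2}` the only component) of the two-vertex game reaches a
cycle in the searched boxes (`m = 3`, exponents `≤ 13`; `m = 4`, `≤ 10`; `m = 5`, `≤ 9`; kit j274142 and the seat's `pointed_search2.py`);
the one-vertex lemma «after END on the point only the point can be big» does NOT transfer to two vertices (e.g. `m = 3`,
`(0,0,6), (2,2,0)` is pointed and its `x₃`-chart successor `(0,0,3), (2,2,1)` has the two tied lines `{0,2}, {1,2}`), so a pointed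
two-vertex play can reach tied positions; whether it can reach a cycle is OPEN in the model.
-/

set_option linter.dupNamespace false -- mandated namespace of this single-conjunct summit

namespace Summit.ResolutionOfSingularities.ResolutionOfSingularities.Theorems

namespace CampaignW42.VertexGame

open Finset Literature.Combinatorics.HironakaPolyhedraGame

variable {m : ℕ}

/-! ## The dictionary: exponents `a` ↦ the generator `a/m` of the one-vertex polyhedron `a/m + ℝ³₊` -/

/-- The generator of Hironaka's game attached to an exponent vector: `a/m ∈ ℚ³`. [folklore] -/
def gen (m : ℕ) (a : Fin 3 → ℕ) : Fin 3 → ℚ :=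
  fun i => (a i : ℚ) / m

/-- The generator set of a one-vertex position. [folklore] -/
def gens₁ (m : ℕ) (s : State) : Finset (Fin 3 → ℚ) := {gen m s.a}

/-- The generator set of a two-vertex position. [folklore] -/
def gens₂ (m : ℕ) (s : State₂) : Finset (Fin 3 → ℚ) := {gen m s.A, gen m s.B}

/-- Sums of the generator's coordinates: `Σ_{j∈S} (a/m)_j = a_S / m`. [folklore] -/
theorem sum_gen (m : ℕ) (a : Fin 3 → ℕ) (S : Finset (Fin 3)) :
    ∑ j ∈ S, gen m a j = ((∑ j ∈ S, a j : ℕ) : ℚ) / m := by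
  simp only [gen, Nat.cast_sum, Finset.sum_div]

/-- `U` is big for `a` (`m ≤ a_U`) iff `U` is permissible for the generator `a/m` (`0 < m`). [folklore] -/
theorem isBig_iff_isPermissible (hm : 0 < m) (a : Fin 3 → ℕ) (U : Finset (Fin 3)) :
    IsBig m a U ↔ IsPermissible {gen m a} U := by
  have hm' : (0 : ℚ) < m := by exact_mod_cast hm
  simp only [IsPermissible, mem_singleton, forall_eq, sum_gen, IsBig, le_div_iff₀ hm', one_mul]
  exact_mod_cast Iff.rfl

/-- **The chart transform IS the printed move `σ_{U,c}`** on generators: `(transform m a U c)/m = gameMove U c (a/m)` whenever the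
centre is big (`m ≤ a_U`, so that the natural-number subtraction is honest) and `0 < m`. [folklore] -/
theorem gen_transform (hm : 0 < m) {a : Fin 3 → ℕ} {U : Finset (Fin 3)} (hU : m ≤ ∑ i ∈ U, a i) (c : Fin 3) :
    gen m (transform m a U c) = gameMove U c (gen m a) := by
  have hm' : (m : ℚ) ≠ 0 := by exact_mod_cast hm.ne'
  funext j
  by_cases hj : j = c
  · subst hj
    rw [gameMove, if_pos rfl, sum_gen, gen, transform_self, Nat.cast_sub hU]
    field_simp
  · rw [gameMove, if_neg hj, gen, gen, transform_ne hj]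

/-! ## One-vertex moves are legal moves of Hironaka's game -/

/-- **Every move of the one-vertex CJS label game is a legal move of Hironaka's game**: the centre's index set `U` is non-empty and
permissible for the generator, the chart `c ∈ U` is player B's answer, and the new generator set is the image under `σ_{U,c}`.
[folklore] -/
theorem step_isGameMove (hm : 0 < m) {s s' : State} (h : Step m s s') :
    ∃ (U : Finset (Fin 3)) (c : Fin 3), U.Nonempty ∧ IsPermissible (gens₁ m s) U ∧ c ∈ U ∧
      gens₁ m s' = (gens₁ m s).image (gameMove U c) := by
  obtain ⟨isEnd, U, c, hcen, hcU, ha, -⟩ := h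
  have hbig : m ≤ ∑ i ∈ U, s.a i := by
    cases hcen with
    | end_ _ hLC =>
      exact le_sum_of_mem_comps (mem_comps_of_mem_leastClass (by rw [hLC]; exact mem_singleton_self _))
    | arr sub hsub hcard =>
      obtain ⟨S, hS⟩ := card_pos.1 (by omega : 0 < sub.card)
      exact le_trans (le_sum_of_mem_comps (mem_comps_of_mem_leastClass (hsub hS)))
        (sum_le_sum_of_subset (subset_biUnion_of_mem id hS))
  refine ⟨U, c, ⟨c, hcU⟩, (isBig_iff_isPermissible hm s.a U).1 hbig, hcU, ?_⟩
  rw [gens₁, gens₁, image_singleton, ha, gen_transform hm hbig]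

/-- «Not yet won» for a one-vertex position is the W-top condition `m < |a|` (the initial form is still `y^m`). [folklore] -/
theorem not_won_gens₁_iff (hm : 0 < m) (s : State) : ¬ Won (gens₁ m s) ↔ m < total s.a := by
  have hm' : (0 : ℚ) < m := by exact_mod_cast hm
  rw [not_won_iff]
  simp only [gens₁, mem_singleton, forall_eq]
  rw [show (∑ j, gen m s.a j) = ((total s.a : ℕ) : ℚ) / m from by rw [total, ← sum_gen], lt_div_iff₀ hm', one_mul]
  exact_mod_cast Iff.rfl

/-! ## Two-vertex moves are legal moves of Hironaka's game -/

/-- Components of a two-vertex position are big for both exponent vectors. [folklore] -/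
theorem le_sum_of_mem_comps₂ {A B : Fin 3 → ℕ} {S : Finset (Fin 3)} (h : S ∈ comps₂ m A B) :
    m ≤ ∑ i ∈ S, A i ∧ m ≤ ∑ i ∈ S, B i := by
  simp only [comps₂, mem_filter, mem_univ, true_and] at h
  exact ⟨h.2.1, h.2.2.1⟩

/-- **Every move of the two-vertex CJS label game is a legal move of Hironaka's game** on the two generators `A/m`, `B/m`.
[folklore] -/
theorem step₂_isGameMove (hm : 0 < m) {s s' : State₂} (h : Step₂ m s s') :
    ∃ (U : Finset (Fin 3)) (c : Fin 3), U.Nonempty ∧ IsPermissible (gens₂ m s) U ∧ c ∈ U ∧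
      gens₂ m s' = (gens₂ m s).image (gameMove U c) := by
  obtain ⟨isEnd, U, c, hcen, hcU, hA, hB, -⟩ := h
  have hbig : m ≤ ∑ i ∈ U, s.A i ∧ m ≤ ∑ i ∈ U, s.B i := by
    cases hcen with
    | end_ _ hLC =>
      have hU : U ∈ leastClass₂ m s := by rw [hLC]; exact mem_singleton_self _
      exact le_sum_of_mem_comps₂ (mem_filter.1 hU).1
    | arr sub hsub hcard =>
      obtain ⟨S, hS⟩ := card_pos.1 (by omega : 0 < sub.card)
      have hSc := le_sum_of_mem_comps₂ (mem_filter.1 (hsub hS)).1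
      have hSU : S ⊆ sub.biUnion id := subset_biUnion_of_mem id hS
      exact ⟨le_trans hSc.1 (sum_le_sum_of_subset hSU), le_trans hSc.2 (sum_le_sum_of_subset hSU)⟩
  refine ⟨U, c, ⟨c, hcU⟩, ?_, hcU, ?_⟩
  · intro a ha
    simp only [gens₂, mem_insert, mem_singleton] at ha
    rcases ha with rfl | rfl
    · exact (isBig_iff_isPermissible hm s.A U).1 hbig.1 _ (mem_singleton_self _)
    · exact (isBig_iff_isPermissible hm s.B U).1 hbig.2 _ (mem_singleton_self _)
  · rw [gens₂, gens₂, image_insert, image_singleton, hA, hB, gen_transform hm hbig.1, gen_transform hm hbig.2]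

/-- «Not yet won» for a two-vertex position is the W-top condition `m < |A| ∧ m < |B|`. [folklore] -/
theorem not_won_gens₂_iff (hm : 0 < m) (s : State₂) : ¬ Won (gens₂ m s) ↔ m < total s.A ∧ m < total s.B := by
  have hm' : (0 : ℚ) < m := by exact_mod_cast hm
  have key : ∀ a : Fin 3 → ℕ, (1 : ℚ) < ∑ j, gen m a j ↔ m < total a := fun a => by
    rw [show (∑ j, gen m a j) = ((total a : ℕ) : ℚ) / m from by rw [total, ← sum_gen], lt_div_iff₀ hm', one_mul]
    exact_mod_cast Iff.rfl
  rw [not_won_iff]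
  simp only [gens₂, mem_insert, mem_singleton, forall_eq_or_imp, forall_eq, key]

/-! ## The witness play of p516000 as an infinite, never-won play of Hironaka's game in dimension 3 -/

/-- Along the witness play every position keeps both orders above `m = 3` (the initial form stays `y³`). [folklore] -/
theorem three_lt_total_P (r : ℕ) (hr : r ≤ 24) : 3 < total (P r).A ∧ 3 < total (P r).B := by
  interval_cases r <;> decide

/-- The positions of `play` are the positions `P r` with raised labels (same exponents). [folklore] -/
theorem play_A_B (n : ℕ) : ∃ r, r ≤ 24 ∧ (play n).A = (P r).A ∧ (play n).B = (P r).B := by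
  by_cases h : n < 16
  · exact ⟨n, by omega, by simp [play, h], by simp [play, h]⟩
  · refine ⟨16 + (n - 16) % 8, by omega, ?_, ?_⟩ <;> simp [play, h, State₂.addLabels]

/-- **[OURS · L1 W4.2] The CJS label rule loses Hironaka's polyhedra game in dimension 3**: the generator sets of the witness play
form an infinite sequence of LEGAL moves (`step₂_isGameMove` with `step_play`) none of whose positions is won. (Spivakovsky's
positional strategy, `Literature…Spivakovsky1983_winningStrategy`, wins from each of them — the label rule is not it.) [folklore] -/
theorem witness_never_won (n : ℕ) : ¬ Won (gens₂ 3 (play n)) := by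
  obtain ⟨r, hr, hA, hB⟩ := play_A_B n
  rw [not_won_gens₂_iff (by norm_num), hA, hB]
  exact three_lt_total_P r hr

/-- The witness play, move by move, in Hironaka's game: permissible non-empty `U_n`, answer `c_n ∈ U_n`, next position
`σ_{U_n,c_n}` of the current one. [folklore] -/
theorem witness_isGameMove (n : ℕ) :
    ∃ (U : Finset (Fin 3)) (c : Fin 3), U.Nonempty ∧ IsPermissible (gens₂ 3 (play n)) U ∧ c ∈ U ∧
      gens₂ 3 (play (n + 1)) = (gens₂ 3 (play n)).image (gameMove U c) :=
  step₂_isGameMove (by norm_num) (step_play n)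

end CampaignW42.VertexGame

end Summit.ResolutionOfSingularities.ResolutionOfSingularities.Theorems
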